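import Mathlib
import HarnessLib
import Literature.Analysis.ODE.CompactSupportFlow
import Literature.Analysis.FluidPDE.VorticityCalculus

/-!
# Route `PoloidalWindowDoor`, crux `PoloidalWindowRigidity` (K2, stmt-NavierStokesRegularity-19708) — LINE 21 «hot_hull» (ns-idea-8 g10):
# H5 `LeafLimit` — the re-based leaves converge to the hot leaf of the hull limit, VERBATIM (Cruxes-local `hotSet` delta-unfolded)

Cell ns-regularity-ideate, seat ns-poloidal-K2-p2 g14 (K2 stub-worker hand).  Statement = `LeafLimit` of `Cruxes/PoloidalWindowRigidity/Lines/hot_hull.lean`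
(v1.1, sha16 e9a3c300f98fe50c; l.1150–1162): if the translates of `v(−1,·)` and `ω(−1,·)` by `γ(τs k)` converge locally uniformly to `U(−1,·)`,
`ω_U(−1,·)` (`ω_U(−1,·)` Lipschitz and bounded, `ω(−1,·)` bounded), then the re-based leaves `σ ↦ γ(τs k + σ) − γ(τs k)` converge pointwise to THE
global integral curve `γ_U` of `ω_U(−1,·)` through `0`, which runs inside `hotSet U`.

PROOF (the line card's: Grönwall).
* `norm_le_of_hasDerivAt_bound`: a curve through `0` with speed `≤ B` stays in `closedBall 0 (B|t|)` (mean value inequality).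
* `dist_le_gronwall_forward`: on `[0, T]` an exact integral curve of a field `X'` that stays in a ball on which `dist (X', Y') ≤ ε` is `ε`-close to
  an `Y'`-trajectory, so Mathlib's `dist_le_of_approx_trajectories_ODE` against the `K`-Lipschitz field `Y'` bounds its distance to the exact
  `Y'`-curve with the same initial point by `gronwallBound 0 K ε T`.
* `tendsto_rebased_curves` (abstract core): fields `X k → Y` locally uniformly on `ℝ³`, `‖X k‖, ‖Y‖ ≤ B`, `Y` Lipschitz; exact curves `c k` of `X k`
  and `cU` of `Y` through `0` ⇒ `c k σ → cU σ` for every `σ` — uniform convergence on the compact ball of radius `B(|σ|+1)+1`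
  (`tendstoLocallyUniformly_iff_forall_isCompact`), the forward Grönwall step for `σ ≥ 0` and the same step for the time-reversed curves
  (fields `−X k`, `−Y`) for `σ < 0`, and `gronwallBound 0 K ε S → 0` as `ε → 0` (`gronwallBound_continuous_ε`).
* `leafLimit` (VERBATIM H5): `γ_U` from the tree's global Picard–Lindelöf `Literature.Analysis.ODE.exists_solution_real_of_lipschitz_of_bound`;
  the re-based leaves are exact curves of the translated vorticity fields; hotness of `γ_U`: the second coordinates of the re-based leaves vanish
  (both ends hot) and `v₂(−1, γ(τs k + σ)) = N` passes to the limit `U₂(−1, γ_U σ)` by `TendstoLocallyUniformly.tendsto_comp` (also at `σ = 0`,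
  giving `U₂(−1,0) = N`).

WHAT THIS IS NOT: not a claim about Navier–Stokes regularity — ODE stability for ONE load-bearing support stub (H5) of an ideator line of a door route
(bears_on LADDER-NS N0, rung N0-LocalTubeDoorPoloidal, W4 ⟨19708⟩); H4 `NullEndTopology`, the research cells NULL-CONTINUUM / PERSISTENT-END /
CONVERGENT-WEB, S0, ⟨27893⟩ stay OPEN; crux 19708 / item 20428 OPEN; NS regularity NOT proved.
-/

noncomputable section

-- the summit and its single sub-problem share the name (CONVENTIONS §1), as in every Theorems file
set_option linter.dupNamespace false

namespace Summit.NavierStokesRegularity.NavierStokesRegularity.Theorems.PoloidalWindowDoorPoloidalWindowRigidityHotHullLeafLimit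

open Set Function Filter Topology Metric
open scoped InnerProductSpace RealInnerProductSpace NNReal
open Literature.Analysis Literature.Analysis.FluidPDE

/-! ## ODE stability core (Mathlib only) -/

section Core

variable {E : Type*} [NormedAddCommGroup E] [NormedSpace ℝ E]

/-- A curve through `0` with speed `≤ B` satisfies `‖f t‖ ≤ B·|t|`. [folklore] -/
theorem norm_le_of_hasDerivAt_bound {f f' : ℝ → E} (hf : ∀ t, HasDerivAt f (f' t) t) {B : ℝ} (hB : ∀ t, ‖f' t‖ ≤ B)
    (h0 : f 0 = 0) (t : ℝ) : ‖f t‖ ≤ B * |t| := by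
  rcases le_or_gt 0 t with ht | ht
  · have h := norm_image_sub_le_of_norm_deriv_le_segment' (f := f) (f' := f') (a := 0) (b := t)
      (fun x _ => (hf x).hasDerivWithinAt) (fun x _ => hB x) t ⟨ht, le_rfl⟩
    rw [abs_of_nonneg ht]
    rwa [h0, sub_zero, sub_zero] at h
  · have h := norm_image_sub_le_of_norm_deriv_le_segment' (f := f) (f' := f') (a := t) (b := 0)
      (fun x _ => (hf x).hasDerivWithinAt) (fun x _ => hB x) 0 ⟨ht.le, le_rfl⟩
    rw [h0, zero_sub, norm_neg, zero_sub] at h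
    rwa [abs_of_neg ht]

/-- **Forward Grönwall step**: an exact `X'`-curve staying where `dist (X', Y') ≤ ε` is `gronwallBound 0 K ε T`-close at time `T ≥ 0` to the exact
curve of the `K`-Lipschitz field `Y'` with the same initial point. [folklore] -/
theorem dist_le_gronwall_forward {X' Y' : E → E} {K : ℝ≥0} (hY : LipschitzWith K Y') {f g : ℝ → E}
    (hf : ∀ t, HasDerivAt f (X' (f t)) t) (hg : ∀ t, HasDerivAt g (Y' (g t)) t) (h0 : f 0 = g 0)
    {S : Set E} {ε T : ℝ} (hT : 0 ≤ T) (hS : ∀ t ∈ Ico 0 T, f t ∈ S) (hε : ∀ x ∈ S, dist (X' x) (Y' x) ≤ ε) :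
    dist (f T) (g T) ≤ gronwallBound 0 K ε T := by
  have h := dist_le_of_approx_trajectories_ODE (v := fun _ => Y') (K := K) (f := f) (g := g) (f' := fun t => X' (f t))
    (g' := fun t => Y' (g t)) (a := 0) (b := T) (εf := ε) (εg := 0) (δ := 0) (fun _ => hY)
    (fun t _ => (hf t).continuousAt.continuousWithinAt) (fun t _ => (hf t).hasDerivWithinAt)
    (fun t ht => hε _ (hS t ht)) (fun t _ => (hg t).continuousAt.continuousWithinAt) (fun t _ => (hg t).hasDerivWithinAt)
    (fun t _ => by rw [dist_self]) (by rw [h0, dist_self]) T ⟨hT, le_rfl⟩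
  simpa using h

/-- **Rebased curves converge** (abstract core of H5): if autonomous fields `X k` converge locally uniformly to a Lipschitz field `Y`, all bounded
by `B`, then the exact `X k`-curves through `0` converge pointwise to the exact `Y`-curve through `0`. [folklore] -/
theorem tendsto_rebased_curves [LocallyCompactSpace E] {X : ℕ → E → E} {Y : E → E} {K : ℝ≥0} (hY : LipschitzWith K Y)
    {B : ℝ} (hBX : ∀ k x, ‖X k x‖ ≤ B) (hXY : TendstoLocallyUniformly X Y atTop)
    {c : ℕ → ℝ → E} (hc : ∀ k σ, HasDerivAt (c k) (X k (c k σ)) σ) (hc0 : ∀ k, c k 0 = 0)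
    {cU : ℝ → E} (hcU : ∀ σ, HasDerivAt cU (Y (cU σ)) σ) (hcU0 : cU 0 = 0) [ProperSpace E] (σ : ℝ) :
    Tendsto (fun k => c k σ) atTop (𝓝 (cU σ)) := by
  rw [Metric.tendsto_nhds]
  intro ε hε
  -- the time horizon and the ball containing all curves up to that time
  set S : ℝ := |σ| with hSdef
  have hS0 : 0 ≤ S := abs_nonneg σ
  set R : ℝ := B * S with hR
  have hcR : ∀ k, ∀ t, |t| ≤ S → c k t ∈ closedBall (0 : E) R := fun k t ht => by
    rw [mem_closedBall, dist_zero_right]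
    have hB0 : 0 ≤ B := (norm_nonneg _).trans (hBX 0 0)
    exact (norm_le_of_hasDerivAt_bound (hc k) (fun t => hBX k (c k t)) (hc0 k) t).trans (mul_le_mul_of_nonneg_left ht hB0)
  -- `gronwallBound 0 K ε' S < ε` for small `ε' > 0`
  obtain ⟨ε', hε', hgb⟩ : ∃ ε' : ℝ, 0 < ε' ∧ gronwallBound 0 K ε' S < ε := by
    have hcont := (gronwallBound_continuous_ε 0 K S).tendsto 0
    rw [gronwallBound_ε0_δ0] at hcont
    obtain ⟨δ, hδ, h⟩ := Metric.eventually_nhds_iff.1 (hcont.eventually (gt_mem_nhds hε))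
    refine ⟨δ / 2, by positivity, h ?_⟩
    rw [dist_zero_right, Real.norm_eq_abs, abs_of_pos (by positivity)]
    linarith
  -- uniform closeness of the fields on the ball, eventually
  have hU : TendstoUniformlyOn X Y atTop (closedBall (0 : E) R) :=
    (tendstoLocallyUniformly_iff_forall_isCompact.1 hXY) _ (isCompact_closedBall 0 R)
  filter_upwards [Metric.tendstoUniformlyOn_iff.1 hU ε' hε'] with k hk
  have hk' : ∀ x ∈ closedBall (0 : E) R, dist (X k x) (Y x) ≤ ε' := fun x hx => by
    rw [dist_comm]; exact (hk x hx).le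
  have hmono : Monotone (gronwallBound 0 K ε') := gronwallBound_mono le_rfl hε'.le K.2
  rcases le_or_gt 0 σ with hσ | hσ
  · -- forward
    have h := dist_le_gronwall_forward hY (hc k) hcU (by rw [hc0, hcU0]) hσ
      (fun t ht => hcR k t (by rw [abs_of_nonneg ht.1, hSdef, abs_of_nonneg hσ]; exact ht.2.le)) hk'
    exact h.trans_lt ((hmono (by rw [hSdef, abs_of_nonneg hσ])).trans_lt hgb)
  · -- backward: time-reversed curves solve the negated fields
    have hYn : LipschitzWith K (fun x => -Y x) := by
      refine LipschitzWith.of_dist_le_mul fun x y => ?_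
      rw [dist_neg_neg]
      exact hY.dist_le_mul x y
    have hcn : ∀ t, HasDerivAt (fun t => c k (-t)) (-X k (c k (-t))) t := fun t => by
      have h := (hc k (-t)).scomp t (hasDerivAt_neg t)
      rw [neg_smul, one_smul] at h
      exact h
    have hcUn : ∀ t, HasDerivAt (fun t => cU (-t)) (-Y (cU (-t))) t := fun t => by
      have h := (hcU (-t)).scomp t (hasDerivAt_neg t)
      rw [neg_smul, one_smul] at h
      exact h
    have h := dist_le_gronwall_forward (X' := fun x => -X k x) (Y' := fun x => -Y x) hYn hcn hcUn
      (by simp only [neg_zero, hc0, hcU0]) (neg_nonneg.2 hσ.le)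
      (fun t ht => hcR k (-t) (by rw [abs_neg, abs_of_nonneg ht.1, hSdef, abs_of_neg hσ]; exact ht.2.le))
      (fun x hx => by rw [dist_neg_neg]; exact hk' x hx)
    simp only [neg_neg] at h
    exact h.trans_lt ((hmono (by rw [hSdef, abs_of_neg hσ])).trans_lt hgb)

end Core

/-! ## H5, VERBATIM -/

/-- **H5 `LeafLimit` of LINE 21 «hot_hull» (VERBATIM; `hotSet` unfolded).**  The re-based leaves converge pointwise to the global hot leaf of the hull
limit through `0`.  See the module docstring. -/
theorem leafLimit :
    ∀ (v U : ℝ → EuclideanSpace ℝ (Fin 3) → EuclideanSpace ℝ (Fin 3)) (γ : ℝ → EuclideanSpace ℝ (Fin 3)) (τs : ℕ → ℝ),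
      (∀ τ : ℝ, HasDerivAt γ (Literature.Analysis.FluidPDE.curl (v (-1)) (γ τ)) τ) →
      (∀ τ : ℝ, γ τ ∈ {y : EuclideanSpace ℝ (Fin 3) | y 2 = 0 ∧ v (-1) y 2 = v (-1) 0 2}) →
      (∃ K : NNReal, LipschitzWith K (Literature.Analysis.FluidPDE.curl (U (-1)))) →
      (∃ B : ℝ, ∀ x, ‖Literature.Analysis.FluidPDE.curl (v (-1)) x‖ ≤ B) →
      (∃ B : ℝ, ∀ x, ‖Literature.Analysis.FluidPDE.curl (U (-1)) x‖ ≤ B) →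
      IsClosed {y : EuclideanSpace ℝ (Fin 3) | y 2 = 0 ∧ U (-1) y 2 = U (-1) 0 2} → Continuous (U (-1)) →
      TendstoLocallyUniformly (fun k x => v (-1) (x + γ (τs k))) (U (-1)) Filter.atTop →
      TendstoLocallyUniformly (fun k x => Literature.Analysis.FluidPDE.curl (v (-1)) (x + γ (τs k)))
        (Literature.Analysis.FluidPDE.curl (U (-1))) Filter.atTop →
      ∃ γU : ℝ → EuclideanSpace ℝ (Fin 3), γU 0 = 0 ∧
        (∀ σ : ℝ, HasDerivAt γU (Literature.Analysis.FluidPDE.curl (U (-1)) (γU σ)) σ) ∧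
        (∀ σ : ℝ, γU σ ∈ {y : EuclideanSpace ℝ (Fin 3) | y 2 = 0 ∧ U (-1) y 2 = U (-1) 0 2}) ∧
        ∀ σ : ℝ, Filter.Tendsto (fun k => γ (τs k + σ) - γ (τs k)) Filter.atTop (nhds (γU σ)) := by
  intro v U γ τs hγ hhot hK hBv hBU _hH hUc hV hW
  obtain ⟨K, hK⟩ := hK
  obtain ⟨Bv, hBv⟩ := hBv
  obtain ⟨BU, hBU⟩ := hBU
  -- the global leaf of the limit field through `0`
  obtain ⟨γU, hγU0, hγU⟩ := Literature.Analysis.ODE.exists_solution_real_of_lipschitz_of_bound hK hBU (0 : EuclideanSpace ℝ (Fin 3))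
  -- the re-based leaves are exact curves of the translated fields
  set c : ℕ → ℝ → EuclideanSpace ℝ (Fin 3) := fun k σ => γ (τs k + σ) - γ (τs k) with hcdef
  have hc : ∀ k σ, HasDerivAt (c k) (curl (v (-1)) (c k σ + γ (τs k))) σ := fun k σ => by
    have h := ((hγ (τs k + σ)).comp_const_add (τs k) σ).sub_const (γ (τs k))
    have e : c k σ + γ (τs k) = γ (τs k + σ) := by simp only [hcdef, sub_add_cancel]
    rw [e]
    exact h
  have hc0 : ∀ k, c k 0 = 0 := fun k => by simp [hcdef]
  have hconv : ∀ σ, Tendsto (fun k => c k σ) atTop (𝓝 (γU σ)) :=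
    tendsto_rebased_curves (X := fun k x => curl (v (-1)) (x + γ (τs k))) hK (fun k x => hBv _) hW hc hc0 hγU hγU0
  refine ⟨γU, hγU0, hγU, fun σ => ⟨?_, ?_⟩, fun σ => hconv σ⟩
  · -- planarity passes to the limit
    have h2 : ∀ k, c k σ 2 = 0 := fun k => by
      simp only [hcdef, PiLp.sub_apply, (hhot _).1, sub_zero]
    have hcl : IsClosed {y : EuclideanSpace ℝ (Fin 3) | y 2 = 0} :=
      isClosed_eq (EuclideanSpace.proj (𝕜 := ℝ) (2 : Fin 3)).continuous continuous_const
    exact hcl.mem_of_tendsto (hconv σ) (Eventually.of_forall h2)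
  · -- hotness passes to the limit (at `σ` and at `0`)
    have hlim : ∀ σ, U (-1) (γU σ) 2 = v (-1) 0 2 := fun σ => by
      have h1 : Tendsto (fun k => v (-1) (c k σ + γ (τs k))) atTop (𝓝 (U (-1) (γU σ))) :=
        hV.tendsto_comp hUc.continuousAt (hconv σ)
      have h2 : Tendsto (fun k => v (-1) (c k σ + γ (τs k)) 2) atTop (𝓝 (U (-1) (γU σ) 2)) :=
        ((EuclideanSpace.proj (𝕜 := ℝ) (2 : Fin 3)).continuous.tendsto _).comp h1
      have h3 : (fun k => v (-1) (c k σ + γ (τs k)) 2) = fun _ => v (-1) 0 2 := funext fun k => by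
        simp only [hcdef, sub_add_cancel]
        exact (hhot _).2
      rw [h3] at h2
      exact tendsto_nhds_unique h2 tendsto_const_nhds
    rw [hlim σ]
    have h0 := hlim 0
    rw [hγU0] at h0
    exact h0.symm

end Summit.NavierStokesRegularity.NavierStokesRegularity.Theorems.PoloidalWindowDoorPoloidalWindowRigidityHotHullLeafLimit

end
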